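import Summits.QuantumFields.YangMills.Theorems.PoincareLipschitzCovariantBridge
import Summits.QuantumFields.YangMills.Theorems.PoincareLipschitzCovariantCurlOfRatio
import Summits.QuantumFields.YangMills.Theorems.PoincareLipschitzCovariantTowerDictionary
import HarnessLib

/-!
# Line «poincare_lipschitz» on crux `HistoryTailL` (stmt-QuantumFields-19936), route crux `BlockLipschitzL` (stmt-QuantumFields-23533), K2 supplier plan,
# (R3)-COV — «F6-ROW-PT»: THE FROZEN (R3)-COV ROW AT ONE BOND OF THE TOWER, IN THE TOWER'S OWN LETTERS — for level-`i` `SU(2)` fields `V, W` with `W`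
# box-ℓ²-ORBIT-MINIMISING w.r.t. `V` on a bond set `S`, plaquette windows `θ_V, θ_W`, an a-priori per-bond chart `‖pertVar V W‖ ≤ s` and the interior
# condition on the pulled-back box around `x₀`:
# `‖pertVar V W ⟨x₀, μ⟩‖² ≤ 8K·Σ_{w ∈ Q_R(0)}‖pertVar V W ⟨x₀ + w, μ⟩‖² + (4K(2R+1)^d + 2)·(64·2^d·d·m·(2R+1))²`,
# `m = √2κ + √2δ + (2R+3)·(2√2θ_V·((d−1)·√2s))`, `κ = (θ_V + θ_W)(1 + 2s + s²) + 2s²`, `δ = d·s²` — every slot of the row supplied BY NAME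

Cell `ym3-torus` (YM ladder rung R3 = continuum SU(2) Yang–Mills on the three-torus — a RUNG, NOT the Clay problem: not d = 4, not infinite volume, not a
mass gap); width seat `ym-ust-19936-w5` gen 11 (bus 2026-08-29T02:3xZ «F6-ROW-PT»; LEAD ym-ust-19936-w1 g7 02:02:59Z (3) displayed row = ✓p688498 FROZEN,
(4) F6 pen = w2 g11, whose F6-IND displays the per-level MASS ROW `hMass` (orbit-minimising ⇒ ℓ²-mass ⇒ walk masses); «F6-ROW» = its supplier).
THEOREMS ONLY (def-free); `--supports stmt-QuantumFields-19936`.  Nothing here proves `hMass` itself, `hStab`, F6, a stub, `BlockLipschitzL`, `HistoryTailL`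
or a summit statement.

WHY.  w2 g11's MASS ROW reads, per level `i` and coarse bond `c`: «`(Ū^iU')^h` orbit-minimising on `S i` ∧ `Σ_{S i}‖pertVar‖² ≤ (2ρ^iX)²` ⇒
`(d+2)L·Σ_{N(c)}‖pertVar (Ū^iU) ((Ū^iU')^h) b‖ ≤ ms_i`».  Its supplier bounds EACH `‖pertVar … b‖`, `b ∈ N(c)`, by the frozen row ✓p688498 read at `b`;
the row's four slots are now all tree theorems in the tower's letters: `hU` (✓`val_inv_unitsSU`), `hcurl` (✓p688574 `norm_curl_ratio_le` with
✓`val_eq_one_add_pertVar_mul`, ✓`norm_R_unitsSU_le`, ✓`norm_plaqU_sub_one_le_of_plaqHol`: `κ = (θ_V+θ_W)(1+s)² + 2s²`), `hdiv`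
(✓`norm_divB_pertVar_le_of_orbitMin`: `δ = d·s²` at the minimiser), `hplaq` (✓`norm_plaqU_sub_one_le_of_plaqHol`), `hS := s`.  This file is that
composition at ONE bond — the knit over `N(c)`, the reading sets (✓p685982) and the `ms_i` schedule are w2's F6-KNIT.  LOCATED (bus 02:2xZ): `κ` and `δ` are
QUADRATIC in the a-priori per-bond size `s` of `pertVar` AT THE MINIMISER, so the row improves on `s` only where `R·s²` and `R²θ·s` are small against the
target — the a-priori chart at the minimiser (ALIGN ✓p688052∕✓p688433 in its own gauge; PHI-MV LOCATE ★w3 g12) is the displayed input `hs` here.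

* ★★★ `normSq_pertVar_le_of_windows_orbitMin` — the title.
[folklore] ([Balaban1985Averaging] §3 (156)–(163) p.42 is the regime; [Balaban1984PropagatorsII] (1.9) p.226 the flat constants).
-/

set_option autoImplicit false

noncomputable section

open scoped BigOperators Matrix.Norms.L2Operator Matrix

namespace Summit.QuantumFields.YangMills.Theorems.PoincareLipschitzCovariantRowAtBond

open Literature.MathematicalPhysics.QuantumFieldTheory.Balaban1983to89
open B4Eq19LatticeOperators (Zd box unitVec add_unitVec_mem_box sub_unitVec_mem_box)
open B9Eq39Adjoint (R R_def covD covDstar curl divB plaqU)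
open B9TorusCalculus (torusT torusT_apply torusT_symm_apply)
open B10Eq27TorusAxialLog (transl transl_zero unitsField toUField)
open BlockAveragingEMLLinearisedBackground (pertVar)
open Summit.QuantumFields.YangMills.Theorems.PoincareLipschitzCovariantBridge (normSq_le_of_cov_curl_div_plaq_torus transl_add_unitVec transl_sub_unitVec)
open Summit.QuantumFields.YangMills.Theorems.PoincareLipschitzCovariantCurlOfRatio (norm_curl_ratio_le)
open Summit.QuantumFields.YangMills.Theorems.PoincareLipschitzCovariantTowerDictionary

variable {P : Params} {i : ℕ}

/-- ★★★ **THE (R3)-COV ROW AT ONE BOND, IN THE TOWER's LETTERS.**  `d ≥ 1`, `R ≥ 4`; level-`i` fields `V W : GaugeField P i SU(2)` with `W` box-ℓ²-orbit-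
minimising w.r.t. `V` on the bond set `S` (the `hmin` of ✓`kirchhoff_of_orbitMin_level` ∕ w2 g11's MASS ROW with `box := (· ∈ S)`); a bond `⟨x₀, μ⟩`; on the
sites `x₀ + w`, `w ∈ Q_{R+3}(0)` (pulled back along `transl x₀`): the `2d` bonds at each such site lie in `S` (interior), every plaquette of `V` based there is
within `θ_V` of `1` and every plaquette of `W` within `θ_W`, and `‖pertVar V W‖ ≤ s` on every bond based there (the a-priori chart); then
`‖pertVar V W ⟨x₀, μ⟩‖² ≤ 8K·Σ_{w ∈ Q_R(0)}‖pertVar V W ⟨x₀ + w, μ⟩‖² + (4K(2R+1)^d + 2)·(64·2^d·d·m·(2R+1))²` with `K = 16(336·d·2^d)^d∕R^d`,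
`m = √2·κ + √2·δ + (2(R+1)+1)·((2√2·θ_V)·((d−1)·(√2·s)))`, `κ = (θ_V + θ_W)·(1 + 2s + s²) + 2s²`, `δ = d·s²`.
Proof: ✓`normSq_le_of_cov_curl_div_plaq_torus` at `U♯ := unitsField (toUField V)`, `A♯ := pertVar V W`, its slots by ✓`val_inv_unitsSU`, ✓`norm_curl_ratio_le`,
✓`norm_divB_pertVar_le_of_orbitMin`, ✓`norm_plaqU_sub_one_le_of_plaqHol`. [folklore] [cite: Balaban1985Averaging, (156)-(163) p.42; Balaban1984PropagatorsII, (1.9) p.226] -/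
theorem normSq_pertVar_le_of_windows_orbitMin (hd : 1 ≤ P.d) (S : Finset (PBond P i)) (V W : GaugeField P i (Matrix.specialUnitaryGroup (Fin 2) ℂ))
    (hmin : ∀ k : GaugeTransf P i (Matrix.specialUnitaryGroup (Fin 2) ℂ),
      (∑ b : PBond P i, if b ∈ S then dist1 (V b * (W b)⁻¹) ^ 2 else 0) ≤
        ∑ b : PBond P i, if b ∈ S then dist1 (V b * (GaugeField.gaugeAct k W b)⁻¹) ^ 2 else 0)
    (x₀ : Site P i) (μ : Fin P.d) {R : ℤ} (hR : 4 ≤ R) {θV θW s : ℝ} (hθV0 : 0 ≤ θV) (hθW0 : 0 ≤ θW) (hs0 : 0 ≤ s)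
    (hS : ∀ w ∈ box (0 : Zd P.d) (R + 3), ∀ ν : Fin P.d, (⟨transl x₀ w, ν⟩ : PBond P i) ∈ S ∧ (⟨(transl x₀ w).unshift ν, ν⟩ : PBond P i) ∈ S)
    (hθV : ∀ w ∈ box (0 : Zd P.d) (R + 3), ∀ p : Plaq P i, p.src = transl x₀ w → dist1 (GaugeField.plaqHol V p) ≤ θV)
    (hθW : ∀ w ∈ box (0 : Zd P.d) (R + 3), ∀ p : Plaq P i, p.src = transl x₀ w → dist1 (GaugeField.plaqHol W p) ≤ θW)
    (hs : ∀ w ∈ box (0 : Zd P.d) (R + 3), ∀ ν : Fin P.d, ‖pertVar V W ⟨transl x₀ w, ν⟩‖ ≤ s) :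
    ‖pertVar V W ⟨x₀, μ⟩‖ ^ 2 ≤
      8 * (16 * (336 * (P.d : ℝ) * (2 : ℝ) ^ P.d) ^ P.d / (R : ℝ) ^ P.d) * ∑ w ∈ box (0 : Zd P.d) R, ‖pertVar V W ⟨transl x₀ w, μ⟩‖ ^ 2 +
      (4 * (16 * (336 * (P.d : ℝ) * (2 : ℝ) ^ P.d) ^ P.d / (R : ℝ) ^ P.d) * (2 * (R : ℝ) + 1) ^ P.d + 2) *
        (64 * (2 : ℝ) ^ P.d * P.d * (Real.sqrt 2 * (((θV + θW) * (1 + 2 * s + s ^ 2) + 2 * s ^ 2)) + Real.sqrt 2 * ((P.d : ℝ) * s ^ 2) +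
          (2 * ((R : ℝ) + 1) + 1) * ((2 * Real.sqrt 2 * θV) * (((P.d : ℝ) - 1) * (Real.sqrt 2 * s)))) * (2 * (R : ℝ) + 1)) ^ 2 := by
  classical
  -- box bookkeeping: the smaller boxes sit inside `Q_{R+3}(0)`
  have hsub1 : box (0 : Zd P.d) (R + 1) ⊆ box (0 : Zd P.d) (R + 3) := B4Eq19LatticeOperators.box_mono 0 (by linarith)
  have hsub2 : box (0 : Zd P.d) (R + 2) ⊆ box (0 : Zd P.d) (R + 3) := B4Eq19LatticeOperators.box_mono 0 (by linarith)
  have hadd1 : ∀ {w : Zd P.d}, w ∈ box (0 : Zd P.d) (R + 1) → ∀ ν, w + unitVec ν ∈ box (0 : Zd P.d) (R + 3) := fun hw ν =>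
    hsub2 (by have := add_unitVec_mem_box hw ν; rwa [show R + 1 + 1 = R + 2 by ring] at this)
  have hsub3 : ∀ {w : Zd P.d}, w ∈ box (0 : Zd P.d) (R + 2) → ∀ ν, w - unitVec ν ∈ box (0 : Zd P.d) (R + 3) := fun hw ν => by
    have := sub_unitVec_mem_box hw ν; rwa [show R + 2 + 1 = R + 3 by ring] at this
  -- the a-priori chart at shifted sites
  have hs_shift : ∀ w ∈ box (0 : Zd P.d) (R + 1), ∀ ν κ' : Fin P.d, ‖pertVar V W ⟨(transl x₀ w).shift ν, κ'⟩‖ ≤ s := by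
    intro w hw ν κ'
    rw [← transl_add_unitVec]
    exact hs _ (hadd1 hw ν) κ'
  have hs_unshift : ∀ w ∈ box (0 : Zd P.d) (R + 2), ∀ ν : Fin P.d, ‖pertVar V W ⟨(transl x₀ w).unshift ν, ν⟩‖ ≤ s := by
    intro w hw ν
    rw [← transl_sub_unitVec]
    exact hs _ (hsub3 hw ν) ν
  refine normSq_le_of_cov_curl_div_plaq_torus hd (fun κ' y => unitsField (toUField V) ⟨y, κ'⟩) (fun ν x => val_inv_unitsSU V ⟨x, ν⟩)
    (fun κ' y => pertVar V W ⟨y, κ'⟩) x₀ hR μ (κ := (θV + θW) * (1 + 2 * s + s ^ 2) + 2 * s ^ 2) (δ := (P.d : ℝ) * s ^ 2) (θ := θV) (S := s)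
    (by positivity) (by positivity) hθV0 hs0 ?_ ?_ ?_ ?_
  · -- hcurl: the κ-slot from both windows and the a-priori chart
    intro w hw ν
    have hx := hsub1 hw
    refine norm_curl_ratio_le (torusT P i) (fun κ' y => unitsField (toUField V) ⟨y, κ'⟩) (fun κ' y => unitsField (toUField W) ⟨y, κ'⟩)
      (fun κ' y => pertVar V W ⟨y, κ'⟩) ν μ (transl x₀ w) (val_eq_one_add_pertVar_mul V W _) (val_eq_one_add_pertVar_mul V W _)
      (val_eq_one_add_pertVar_mul V W _) (val_eq_one_add_pertVar_mul V W _) (fun X => norm_R_unitsSU_le V _ X) (fun X => norm_R_unitsSU_le V _ X) hs0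
      (hs w hx ν) ?_ ?_ (hs w hx μ) ?_ ?_
    · simpa only [torusT_apply] using hs_shift w hw ν μ
    · simpa only [torusT_apply] using hs_shift w hw μ ν
    · by_cases hne : μ = ν
      · subst hne
        simp only [plaqU, mul_inv_cancel_right, mul_inv_cancel, Units.val_one, sub_self, norm_zero]
        exact hθV0
      · exact norm_plaqU_sub_one_le_of_plaqHol V (transl x₀ w) (hθV w hx) hne
    · by_cases hne : μ = ν
      · subst hne
        simp only [plaqU, mul_inv_cancel_right, mul_inv_cancel, Units.val_one, sub_self, norm_zero]
        exact hθW0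
      · exact norm_plaqU_sub_one_le_of_plaqHol W (transl x₀ w) (hθW w hx) hne
  · -- hdiv: the δ-slot from the orbit minimiser
    intro w hw
    exact norm_divB_pertVar_le_of_orbitMin (· ∈ S) V W hmin (transl x₀ w) (fun ν => hS w (hsub2 hw) ν) hs0
      (fun ν => ⟨hs w (hsub2 hw) ν, hs_unshift w hw ν⟩)
  · -- hplaq: the background's window
    intro w hw ν hne
    exact norm_plaqU_sub_one_le_of_plaqHol V (transl x₀ w) (hθV w (hsub2 hw)) hne
  · -- hS: the a-priori chart
    intro w hw ν
    exact hs w hw ν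

end Summit.QuantumFields.YangMills.Theorems.PoincareLipschitzCovariantRowAtBond

end
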